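import Literature.Analysis.OperatorTheory.Enflo2023.CaseIIT
import HarnessLib

/-!
# Enflo 2023, v2 eq. (27) with the operator AND CYCLIC vectors: (27) fails for the minimiser of (26) with `y`, `x₀` cyclic

Source under adjudication: Per H. Enflo, *On the invariant subspace problem in Hilbert spaces*, arXiv:2305.15442 (v1
2023, v2 2024), bib key `Enflo2023` — a CLAIMED proof of the invariant subspace problem for operators on a separable
Hilbert space.  This file is part of the kernel-tight typing of the manuscript by the b2b-enflo repair cell
(formaliser 1, Part A: v2 eq. (1)–(27)).  It records, where a step does not follow, the typed inference together
with its refutation.  NOTHING here asserts that the manuscript's main theorem holds; no declaration concludes the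
invariant subspace problem for an arbitrary operator.  Value (BLOCK-2b): theorems / refutations of typed inferences
about a text — not progress on the problem.

WHAT THIS FILE ADDS.  `CaseIIT.lean` refutes the p.13 inference (26) ⟹ (27) with the operator written into it and
every standing hypothesis of v2 pp.1–2 (`Eq27Inference`, `Eq27InferenceSA`), but its module docstring lists as NOT
MODELLED the manuscript's other running assumption: the vectors in play are CYCLIC ("if some `y` is non-cyclic we
are done", v2 p.1 and p.3 — `Basic.lean`: `IsNonCyclic T y := orbitClosure T y ≠ ⊤`) — indeed the `CaseIIT` /
`RoomClaimT` witness operator `D` has the eigenvalue `10⁻²⁰` with multiplicity `4`, so it has no cyclic vector at all.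
This file closes that gap for the (27) row of the repair census:
  * `Eq27InferenceCyc` — `Eq27InferenceSA` (separable infinite-dimensional `H`; `T` injective, `R(T) ≠ H`, `R(T)`
    dense, `0 ∈ σ(T)`, `‖T‖ = 10⁻²⁰`, self-adjoint, of Type 1 via `u₀` with `y` in the cone; the data of (26); Case
    II for ALL `j ≥ 1`, strict; `a` THE norm-minimal solution of (26)) PLUS `¬ IsNonCyclic T y` AND
    `¬ IsNonCyclic T x₀`  ⟹  (27): `‖V_y a − (1+δ)y‖ < (εθ)²`;  `eq27InferenceCyc_of_eq27InferenceSA`.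
VERDICT: `not_eq27InferenceCyc` (hence, once more, `not_eq27InferenceSA` / `not_eq27Inference` of `CaseIIT.lean`).
Witness (`CaseII.ModelC`) on `ℓ²(ℕ)`: the diagonal operator `D_c` with the DISTINCT weights `w_k = 10⁻²⁰/(k+1)`
(self-adjoint, injective, dense non-closed range, `0 ∈ σ(D_c)`, `‖D_c‖ = 10⁻²⁰` attained at `e₀`, of Type 1 via
`u₀ = e₀` with `δ_n = 10^{-20n}/10⁴`), for which EVERY VECTOR WITH ALL COORDINATES NON-ZERO IS CYCLIC
(`ModelC.orbitClosure_eq_top`: a vector `v ⊥ {D_c^j f}_j` has `Σ_k w_k^j conj(f_k) v_k = 0` for all `j ≥ 0`, and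
vanishing power moments against distinct decreasing weights force `conj(f_k) v_k = 0` — `eq_zero_of_moments_eq_zero`,
by domination at the least non-zero index `m`: `|a_m| ≤ (w_{m+1}/w_m)^j ‖a‖₁ → 0`), and the EXPLICIT data, for
every `εθ ∈ [10⁻²⁶, 10⁻²³]`:
    `y  = Σ_k (4/5)2^{-k} e_k`                                            (`‖y‖² = 64/75`, `Re⟨e₀, y⟩ = 4/5 ≥ ‖y‖/100`),
    `x₀ = y + εθ(−(5/24)e₀ + 10e₁ − (135/2)e₂ + (320/3)e₃) + s(e₃₀₀ − 2e₃₀₁)`,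
    `s = ((11/75 − 2εθ − γ'(εθ)²)/5)^{1/2}`, `γ' = 9235625/576`,
so that ALL coordinates of `y` and of `x₀` are non-zero (both CYCLIC), `‖x₀‖ = 1` and `⟨y, x₀ − y⟩ = εθ` EXACTLY (the
bulk `s(e₃₀₀ − 2e₃₀₁)` is orthogonal to `y`), `‖x₀ − y‖² = 11/75 − 2εθ` (`≈ 0.383²`, inside Lemma 1's `(0.3, 0.5]`),
`⟨y, D_c y⟩ ≥ (11/15)·10⁻²⁰ ≥ 10⁻²¹`, `dist(D_c y, ℂy) ≥ (23/160)·10⁻²⁰ ≥ 10⁻²¹` (coordinate `k = 1`), and Case II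
for EVERY `j ≥ 1`: the node coefficients `c = (−1/6, 4, −27/2, 32/3)` are the Lagrange weights of the nodes
`(1, 1/2, 1/3, 1/4)` (`= w_k/10⁻²⁰`, `k ≤ 3`) at `0` (`Σcᵢ = 1`, `Σcᵢrᵢ^j = 0` for `j = 1, 2, 3`, `Σ|cᵢ| = 85/3`), so
`⟨D_c^j y, x₀ − y⟩ = εθ·Σcᵢ(10⁻²⁰rᵢ)^j + (bulk, ≤ 10⁻²⁰/2²⁹⁵ in size)` is `≤ 10⁻²⁰/2²⁹⁵ < (εθ)⁴` for `j ≤ 3` and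
`≤ (85/3)·10⁻⁸⁰·εθ + 10⁻²⁰/2²⁹⁵ < (εθ)⁴` for `j ≥ 4` (this is where `εθ ≥ 10⁻²⁶` enters).  Problem (1) for `V_y` at
`ε' = ‖x₀ − (1+δ)y‖ < 1` has a minimal solution (`(1+δ)e₀` feasible, `ℓ²` complete) and
`CaseII.eq27_false_for_minimal` fires on it: the minimal move is `≥ (εθ)²`, contradicting (27) (`ModelC.facts`,
`minimal_window_satisfiable_C`).  So cyclicity of the named vectors — like injectivity, dense range, `0 ∈ σ(T)`,
`‖T‖ = 10⁻²⁰`, self-adjointness and Type 1 — does not enter or repair the p.13 inference; the text's justification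
of (27) (tex:L410–416) uses none of them.  STILL NOT MODELLED: "EVERY non-zero vector is cyclic" (that is `¬`ISP for
the witness operator and cannot be exhibited by any explicit model; the manuscript only ever invokes it for the
vectors it names), the Type-1 form `x₀ = (√3/2)u₀ + ½u₁` (v2 p.7), and `y` being an actual iterate of the Main
Construction.
Conventions: Mathlib's `⟪u, v⟫_ℂ` is conjugate-linear in `u`; the paper's `⟨u, v⟩` is `⟪v, u⟫_ℂ`; `T^j x` is
`(T ^ j) x` (operator power) except inside the Type-1 clause, which follows `TypeDichotomy.lean`'s `(⇑T)^[j] x`.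
STATUS: CLOSED (zero sorry); axioms `[propext, Classical.choice, Quot.sound]`.
Origin: planner-b2b-enflo-1-g3-0 (formaliser 1, gen 3), 2026-08-18.
-/

open scoped InnerProductSpace ENNReal ComplexConjugate
open Literature.Analysis.UnboundedOperators (inner_self_eq_coe_norm_sq)

noncomputable section

namespace Literature.Analysis.OperatorTheory.Enflo2023

/-! ### (1) The inference at (27) with the operator in it and `y`, `x₀` cyclic, typed -/

/-- v2 p.13, (26) ⟹ (27), typed WITH THE OPERATOR, ITS STANDING HYPOTHESES, AND THE "OTHERWISE WE ARE DONE"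
HYPOTHESES ON THE NAMED VECTORS: everything of `Eq27InferenceSA` (separable infinite-dimensional `H`; `T`
injective, not surjective, dense range, `0 ∈ σ(T)`, `‖T‖ = 10⁻²⁰`, self-adjoint; Type 1 via `u₀` with `y` in the
cone; the data of (26); Case II for all `j ≥ 1`; `a` THE minimiser of (26)) PLUS `y` and `x₀` CYCLIC for `T`
(`¬ IsNonCyclic`, i.e. their orbits span dense subspaces — the manuscript's standing "otherwise `T` has a non-trivial
closed invariant subspace and we are done", v2 p.1 and p.3).  Conclusion (27): `‖V_y a − (1+δ)y‖ < (εθ)²`.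
Refuted below (`not_eq27InferenceCyc`). [cite: Enflo2023, v2 p.13, eq. (26)–(27); pp.1–3; p.6] -/
@[claim "Enflo2023" "disputed"]
def Eq27InferenceCyc : Prop :=
  ∀ (H : Type) [NormedAddCommGroup H] [InnerProductSpace ℂ H] [CompleteSpace H]
    [TopologicalSpace.SeparableSpace H], ¬ FiniteDimensional ℂ H →
  ∀ (T : H →L[ℂ] H) (hT1 : ‖T‖ < 1) (u₀ x₀ y : H) (et : ℝ) (a : Vy.ℓ2),
    Function.Injective T → ¬ Function.Surjective T → DenseRange T → (0 : ℂ) ∈ spectrum ℂ T →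
    ‖T‖ = 1 / 10 ^ 20 → IsSelfAdjoint T →
    ‖u₀‖ = 1 →
    (∀ n : ℕ, 1 ≤ n → ∃ δ : ℝ, 0 < δ ∧ ∀ y' : H, Referee.AngleCond u₀ y' →
        ∃ j : ℕ, n ≤ j ∧ δ * ‖y'‖ ^ 2 ≤ ‖⟪(⇑T)^[j] y', y'⟫_ℂ‖) →
    Referee.AngleCond u₀ y →
    ¬ IsNonCyclic T y → ¬ IsNonCyclic T x₀ →
    ‖x₀‖ = 1 → ⟪x₀ - y, y⟫_ℂ = (et : ℂ) → 0 < et → et ≤ 1 / 10 ^ 23 →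
    (0.3 : ℝ) ≤ ‖x₀ - y‖ → ‖x₀ - y‖ ≤ 0.7 →
    (∀ j : ℕ, 1 ≤ j → ‖⟪x₀ - y, (T ^ j) y⟫_ℂ‖ < et ^ 4) →
    IsMinimal (Vy.V T hT1 y) x₀ ‖x₀ - ((1 + et / 10 : ℝ) : ℂ) • y‖ a →
    ‖Vy.V T hT1 y a - ((1 + et / 10 : ℝ) : ℂ) • y‖ < et ^ 2

/-- Adding the two cyclicity hypotheses only weakens the claim: `Eq27InferenceSA → Eq27InferenceCyc` (so refuting the
latter refutes `Eq27InferenceSA` and `Eq27Inference` once more). [cite: Enflo2023, v2 p.13, eq. (26)–(27)] -/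
theorem eq27InferenceCyc_of_eq27InferenceSA (h : Eq27InferenceSA) : Eq27InferenceCyc := by
  intro H _ _ _ _ hinf T hT1 u₀ x₀ y et a hinj hsurj hdense hspec hnorm hsa hu₀ htype hang _ _ h0 hey het0 het2
    hρ1 hρ2 hcase hmin
  exact h H hinf T hT1 u₀ x₀ y et a hinj hsurj hdense hspec hnorm hsa hu₀ htype hang h0 hey het0 het2 hρ1 hρ2 hcase
    hmin

/-! ### (2) The model operator: the diagonal operator with DISTINCT weights `10⁻²⁰/(k+1)` on `ℓ²(ℕ)` -/

namespace CaseII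

namespace ModelC

open RoomModelT (ℓ2T summable_sq)
open WindowModelT (lam lam_def)

set_option exponentiation.threshold 512

/-- The weights `w_k = λ/(k+1)`, `λ = 10⁻²⁰` — positive, `≤ λ`, strictly decreasing, pairwise distinct. [folklore] -/
def wgt (k : ℕ) : ℝ := lam / (k + 1)

/-- `0 < λ ≤ 1`. [folklore] -/
lemma lam_pos_le : 0 < lam ∧ lam ≤ 1 := by rw [lam_def]; norm_num

/-- `w_k > 0`. [folklore] -/
lemma wgt_pos (k : ℕ) : 0 < wgt k := by unfold wgt; exact div_pos lam_pos_le.1 (by positivity)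

/-- `w_k ≤ λ`. [folklore] -/
lemma wgt_le (k : ℕ) : wgt k ≤ lam := by
  unfold wgt
  exact div_le_self lam_pos_le.1.le (by have := Nat.cast_nonneg (α := ℝ) k; linarith)

/-- `w_k < 1`. [folklore] -/
lemma wgt_lt_one (k : ℕ) : wgt k < 1 := (wgt_le k).trans_lt (by rw [lam_def]; norm_num)

/-- `w_0 = λ`. [folklore] -/
lemma wgt_zero : wgt 0 = lam := by unfold wgt; simp

/-- The weights decrease: `w_k ≤ w_{m+1}` for `k ≥ m+1`. [folklore] -/
lemma wgt_le_wgt_succ {m k : ℕ} (hk : m + 1 ≤ k) : wgt k ≤ wgt (m + 1) := by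
  unfold wgt
  have h : ((m : ℝ) + 1) + 1 ≤ (k : ℝ) + 1 := by
    have : (m : ℝ) + 1 ≤ k := by exact_mod_cast hk
    linarith
  push_cast
  exact div_le_div_of_nonneg_left lam_pos_le.1.le (by positivity) h

/-- The ratio of consecutive weights is `< 1`. [folklore] -/
lemma wgt_succ_div_lt_one (m : ℕ) : wgt (m + 1) / wgt m < 1 := by
  rw [div_lt_one (wgt_pos m)]
  unfold wgt
  push_cast
  exact div_lt_div_of_pos_left lam_pos_le.1 (by positivity) (by linarith)

/-- Pointwise multiplication by the weights preserves `ℓ²`. [folklore] -/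
lemma memℓp_wgt_mul (f : ℓ2T) : Memℓp (fun k => ((wgt k : ℝ) : ℂ) * f k) 2 := by
  rw [memℓp_gen_iff (by norm_num : 0 < (2 : ℝ≥0∞).toReal)]
  simp only [ENNReal.toReal_ofNat, Real.rpow_two]
  refine Summable.of_nonneg_of_le (fun k => by positivity) (fun k => ?_) (summable_sq f)
  rw [norm_mul, mul_pow, Complex.norm_real, Real.norm_eq_abs, abs_of_pos (wgt_pos k)]
  have h1 : wgt k ^ 2 ≤ 1 := by nlinarith [wgt_pos k, wgt_lt_one k]
  have h2 : 0 ≤ ‖f k‖ ^ 2 := by positivity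
  nlinarith

/-- The diagonal operator as a linear map. [folklore] -/
def Dlin : ℓ2T →ₗ[ℂ] ℓ2T where
  toFun f := ⟨fun k => ((wgt k : ℝ) : ℂ) * f k, memℓp_wgt_mul f⟩
  map_add' f g := by
    apply lp.ext
    funext k
    simp [mul_add]
  map_smul' c f := by
    apply lp.ext
    funext k
    simp [lp.coeFn_smul, mul_left_comm]

/-- Coordinates of the linear diagonal map. [folklore] -/
lemma Dlin_apply (f : ℓ2T) (k : ℕ) : (Dlin f) k = ((wgt k : ℝ) : ℂ) * f k := rfl

/-- Norm bound `‖D f‖ ≤ λ‖f‖`. [folklore] -/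
lemma norm_Dlin_le (f : ℓ2T) : ‖Dlin f‖ ≤ lam * ‖f‖ := by
  have h1 := lp.norm_rpow_eq_tsum (by norm_num : 0 < (2 : ℝ≥0∞).toReal) (Dlin f)
  have h2 := lp.norm_rpow_eq_tsum (by norm_num : 0 < (2 : ℝ≥0∞).toReal) f
  simp only [ENNReal.toReal_ofNat, Real.rpow_two] at h1 h2
  have hle : ∑' k, ‖(Dlin f) k‖ ^ 2 ≤ ∑' k, lam ^ 2 * ‖f k‖ ^ 2 := by
    refine Summable.tsum_le_tsum (fun k => ?_) (summable_sq (Dlin f)) ((summable_sq f).mul_left _)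
    rw [Dlin_apply, norm_mul, mul_pow, Complex.norm_real, Real.norm_eq_abs, abs_of_pos (wgt_pos k)]
    exact mul_le_mul_of_nonneg_right (pow_le_pow_left₀ (wgt_pos k).le (wgt_le k) 2) (by positivity)
  rw [tsum_mul_left] at hle
  have h3 : ‖Dlin f‖ ^ 2 ≤ (lam * ‖f‖) ^ 2 := by
    calc ‖Dlin f‖ ^ 2 = ∑' k, ‖(Dlin f) k‖ ^ 2 := h1
      _ ≤ lam ^ 2 * ∑' k, ‖f k‖ ^ 2 := hle
      _ = (lam * ‖f‖) ^ 2 := by rw [mul_pow, h2]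
  exact (pow_le_pow_iff_left₀ (norm_nonneg _) (by have := lam_pos_le.1; positivity) two_ne_zero).1 h3

/-- **The model operator `D_c`**: diagonal with the distinct weights `w_k = 10⁻²⁰/(k+1)`. [folklore] -/
def Dc : ℓ2T →L[ℂ] ℓ2T := Dlin.mkContinuous lam norm_Dlin_le

/-- Coordinates of `D_c`: `(D_c f)_k = w_k f_k`. [folklore] -/
@[simp] lemma Dc_apply (f : ℓ2T) (k : ℕ) : (Dc f) k = ((wgt k : ℝ) : ℂ) * f k := rfl

/-- `D_c e_k = w_k e_k` on the standard unit vectors. [folklore] -/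
lemma Dc_single (k : ℕ) : Dc (lp.single 2 k (1 : ℂ)) = ((wgt k : ℝ) : ℂ) • lp.single 2 k (1 : ℂ) := by
  apply lp.ext
  funext m
  rw [lp.coeFn_smul, Pi.smul_apply, Dc_apply, smul_eq_mul, lp.single_apply]
  by_cases hm : m = k
  · rw [hm, Pi.single_eq_same]
  · rw [Pi.single_eq_of_ne hm, mul_zero, mul_zero]

/-- `D_c` is injective (all weights non-zero). [folklore] -/
lemma Dc_injective : Function.Injective Dc := by
  refine (injective_iff_map_eq_zero Dc).2 (fun f hf => ?_)
  apply lp.ext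
  funext k
  have hk := congrArg (fun g : ℓ2T => g k) hf
  simp only [Dc_apply, lp.coeFn_zero, Pi.zero_apply, mul_eq_zero, Complex.ofReal_eq_zero] at hk
  rcases hk with hk | hk
  · exact absurd hk (wgt_pos k).ne'
  · simpa using hk

/-- `D_c` is self-adjoint (real weights). [folklore] -/
lemma Dc_isSelfAdjoint : IsSelfAdjoint Dc := by
  rw [ContinuousLinearMap.isSelfAdjoint_iff_isSymmetric]
  intro f g
  change ⟪Dc f, g⟫_ℂ = ⟪f, Dc g⟫_ℂ
  rw [lp.inner_eq_tsum, lp.inner_eq_tsum]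
  congr 1
  funext k
  rw [Dc_apply, Dc_apply, RCLike.inner_apply', RCLike.inner_apply', map_mul, Complex.conj_ofReal]
  ring

/-- The weight sequence itself is in `ℓ²` (`w_k² ≤ 1/(k+1)²`). [folklore] -/
lemma memℓp_wgt : Memℓp (fun k => ((wgt k : ℝ) : ℂ)) 2 := by
  rw [memℓp_gen_iff (by norm_num : 0 < (2 : ℝ≥0∞).toReal)]
  simp only [ENNReal.toReal_ofNat, Real.rpow_two, Complex.norm_real, Real.norm_eq_abs, sq_abs]
  have hs : Summable (fun n : ℕ => 1 / ((n : ℝ) + 1) ^ 2) := by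
    have := (summable_nat_add_iff 1).mpr (Real.summable_one_div_nat_pow.mpr one_lt_two)
    simpa [Nat.cast_add, Nat.cast_one] using this
  refine Summable.of_nonneg_of_le (fun k => sq_nonneg _) (fun k => ?_) hs
  unfold wgt
  rw [div_pow]
  have hl : lam ^ 2 ≤ 1 := by rw [lam_def]; norm_num
  exact div_le_div_of_nonneg_right hl (by positivity)

/-- `D_c` is not surjective: `(w_k)_k ∈ ℓ²` has the non-`ℓ²` preimage `(1,1,1,…)`. [folklore] -/
lemma Dc_not_surjective : ¬ Function.Surjective Dc := by
  intro hs
  obtain ⟨f, hf⟩ := hs ⟨fun k => ((wgt k : ℝ) : ℂ), memℓp_wgt⟩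
  have hk : ∀ k, f k = 1 := by
    intro k
    have h := congrArg (fun g : ℓ2T => g k) hf
    simp only [Dc_apply] at h
    have hd : ((wgt k : ℝ) : ℂ) ≠ 0 := Complex.ofReal_ne_zero.mpr (wgt_pos k).ne'
    have h' : ((wgt k : ℝ) : ℂ) * f k = ((wgt k : ℝ) : ℂ) * 1 := by rw [mul_one]; exact h
    exact mul_left_cancel₀ hd h'
  have ht := (summable_sq f).tendsto_atTop_zero
  simp only [hk, norm_one, one_pow] at ht
  have := tendsto_nhds_unique ht tendsto_const_nhds
  exact zero_ne_one this

/-- `D_c` has dense range (self-adjoint and injective). [folklore] -/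
lemma Dc_denseRange : DenseRange Dc := by
  have hker : LinearMap.ker (Dc : ℓ2T →ₗ[ℂ] ℓ2T) = ⊥ :=
    LinearMap.ker_eq_bot.mpr (by exact Dc_injective)
  have h1 := Dc.orthogonal_ker
  rw [hker, Submodule.bot_orthogonal_eq_top, ContinuousLinearMap.isSelfAdjoint_iff'.1 Dc_isSelfAdjoint] at h1
  have h2 : Dense ((LinearMap.range (Dc : ℓ2T →ₗ[ℂ] ℓ2T) : Submodule ℂ ℓ2T) : Set ℓ2T) :=
    Submodule.dense_iff_topologicalClosure_eq_top.mpr h1.symm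
  have h3 : ((LinearMap.range (Dc : ℓ2T →ₗ[ℂ] ℓ2T) : Submodule ℂ ℓ2T) : Set ℓ2T) = Set.range Dc := by
    ext x
    simp only [SetLike.mem_coe, LinearMap.mem_range, Set.mem_range, ContinuousLinearMap.coe_coe]
  rw [h3] at h2
  exact h2

/-- `0 ∈ σ(D_c)` (not surjective ⇒ not invertible). [folklore] -/
lemma zero_mem_spectrum_Dc : (0 : ℂ) ∈ spectrum ℂ Dc := by
  rw [spectrum.mem_iff, map_zero, zero_sub, IsUnit.neg_iff]
  intro hu
  apply Dc_not_surjective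
  obtain ⟨u, hu⟩ := hu
  intro y
  refine ⟨(↑u⁻¹ : ℓ2T →L[ℂ] ℓ2T) y, ?_⟩
  have h := congrArg (fun S : ℓ2T →L[ℂ] ℓ2T => S y) u.mul_inv
  rw [hu] at h
  simpa using h

/-- `‖D_c‖ = λ = 10⁻²⁰` (attained at `e₀`). [folklore] -/
lemma norm_Dc : ‖Dc‖ = 1 / 10 ^ 20 := by
  rw [← lam_def]
  refine le_antisymm (LinearMap.mkContinuous_norm_le _ lam_pos_le.1.le _) ?_
  have h1 := Dc.le_opNorm (lp.single 2 0 (1 : ℂ))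
  have h2 : ‖(lp.single 2 0 (1 : ℂ) : ℓ2T)‖ = 1 := by
    rw [lp.norm_single (by norm_num)]; simp
  rw [Dc_single, norm_smul, h2, wgt_zero, Complex.norm_real, Real.norm_eq_abs, abs_of_pos lam_pos_le.1, mul_one,
    mul_one] at h1
  exact h1

/-- `‖D_c‖ ≤ 10⁻²⁰`. [folklore] -/
lemma norm_Dc_le : ‖Dc‖ ≤ 1 / 10 ^ 20 := norm_Dc.le

/-- `‖D_c‖ < 1`. [folklore] -/
lemma norm_Dc_lt_one : ‖Dc‖ < 1 := by rw [norm_Dc]; norm_num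

/-- Coordinates of the operator powers: `(D_c^j f)_k = w_k^j f_k`. [folklore] -/
lemma Dc_pow_apply (j : ℕ) (f : ℓ2T) (k : ℕ) : ((Dc ^ j) f) k = ((wgt k : ℝ) : ℂ) ^ j * f k := by
  induction j generalizing f with
  | zero => simp
  | succ j ih =>
    rw [pow_succ]
    change ((Dc ^ j) (Dc f)) k = _
    rw [ih, Dc_apply]
    ring

/-- Coordinates of the iterates: `(D_c^n f)_k = w_k^n f_k`. [folklore] -/
lemma Dc_iterate_apply (n : ℕ) (f : ℓ2T) (k : ℕ) : ((⇑Dc)^[n] f) k = ((wgt k : ℝ) : ℂ) ^ n * f k := by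
  induction n with
  | zero => simp
  | succ n ih => rw [Function.iterate_succ_apply', Dc_apply, ih]; ring

/-- The terms `w_k^n |f_k|²` are summable. [folklore] -/
lemma summable_wgt_pow_mul_sq (n : ℕ) (f : ℓ2T) : Summable (fun k => wgt k ^ n * ‖f k‖ ^ 2) := by
  refine Summable.of_nonneg_of_le (fun k => by have := wgt_pos k; positivity) (fun k => ?_) (summable_sq f)
  have h1 : wgt k ^ n ≤ 1 := pow_le_one₀ (wgt_pos k).le (wgt_lt_one k).le
  have h2 : 0 ≤ ‖f k‖ ^ 2 := by positivity
  nlinarith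

/-- `⟨D_c^n f, f⟩ = Σ_k w_k^n |f_k|²` (real, non-negative). [folklore] -/
lemma inner_Dc_iterate (n : ℕ) (f : ℓ2T) :
    ⟪(⇑Dc)^[n] f, f⟫_ℂ = ((∑' k, wgt k ^ n * ‖f k‖ ^ 2 : ℝ) : ℂ) := by
  rw [lp.inner_eq_tsum, Complex.ofReal_tsum]
  congr 1
  funext k
  rw [Dc_iterate_apply, RCLike.inner_apply', map_mul, map_pow, Complex.conj_ofReal, mul_assoc,
    Complex.conj_mul']
  push_cast
  ring

/-- `⟨f, D_c f⟩ = Σ_k w_k |f_k|²`. [folklore] -/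
lemma inner_self_Dc (f : ℓ2T) : ⟪f, Dc f⟫_ℂ = ((∑' k, wgt k * ‖f k‖ ^ 2 : ℝ) : ℂ) := by
  rw [lp.inner_eq_tsum, Complex.ofReal_tsum]
  congr 1
  funext k
  rw [Dc_apply, RCLike.inner_apply', mul_left_comm, Complex.conj_mul']
  push_cast
  ring

/-- **`D_c` is of Type 1 via `u₀ = e₀`**, with `δ_n = λ^n/10⁴` and `j = n`: for `f` in the cone `Re f₀ ≥ ‖f‖/100`,
`⟨D_c^n f, f⟩ ≥ w₀^n |f₀|² ≥ λ^n‖f‖²/10⁴`. [cite: Enflo2023, v2 p.6] -/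
theorem Dc_type1_via_e0 (n : ℕ) (_hn : 1 ≤ n) : ∃ δ : ℝ, 0 < δ ∧ ∀ f : ℓ2T,
    Referee.AngleCond (lp.single 2 0 (1 : ℂ) : ℓ2T) f →
    ∃ j : ℕ, n ≤ j ∧ δ * ‖f‖ ^ 2 ≤ ‖⟪(⇑Dc)^[j] f, f⟫_ℂ‖ := by
  refine ⟨lam ^ n / 10 ^ 4, by have := lam_pos_le.1; positivity, fun f hf => ⟨n, le_rfl, ?_⟩⟩
  obtain ⟨-, hang⟩ := hf
  have h1 : (⟪(lp.single 2 0 (1 : ℂ) : ℓ2T), f⟫_ℂ).re = (f 0).re := by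
    rw [lp.inner_single_left, RCLike.inner_apply', map_one, one_mul]
  rw [h1] at hang
  have hs := summable_wgt_pow_mul_sq n f
  have h2 : wgt 0 ^ n * ‖f 0‖ ^ 2 ≤ ∑' k, wgt k ^ n * ‖f k‖ ^ 2 :=
    hs.le_tsum 0 (fun k _ => by have := wgt_pos k; positivity)
  rw [wgt_zero] at h2
  rw [inner_Dc_iterate, Complex.norm_real, Real.norm_of_nonneg
    (tsum_nonneg (fun k => by have := wgt_pos k; positivity))]
  have h3 : |(f 0).re| ≤ ‖f 0‖ := Complex.abs_re_le_norm _
  have h4 : (1 / 100 : ℝ) * ‖f‖ ≤ ‖f 0‖ := hang.trans ((le_abs_self _).trans h3)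
  have h5 : ((1 / 100 : ℝ) * ‖f‖) ^ 2 ≤ ‖f 0‖ ^ 2 := pow_le_pow_left₀ (by positivity) h4 2
  have h6 : (0 : ℝ) ≤ lam ^ n := pow_nonneg lam_pos_le.1.le n
  calc lam ^ n / 10 ^ 4 * ‖f‖ ^ 2 = lam ^ n * ((1 / 100 : ℝ) * ‖f‖) ^ 2 := by ring
    _ ≤ lam ^ n * ‖f 0‖ ^ 2 := mul_le_mul_of_nonneg_left h5 h6
    _ ≤ ∑' k, wgt k ^ n * ‖f k‖ ^ 2 := h2

/-- `D_c` is of Type 1 (v2 p.6). [cite: Enflo2023, v2 p.6] -/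
theorem Dc_type1 : Referee.Type1 Dc :=
  ⟨lp.single 2 0 (1 : ℂ), by rw [lp.norm_single (by norm_num)]; simp, Dc_type1_via_e0⟩

/-! ### (3) Cyclic vectors of `D_c`: every vector with all coordinates non-zero is cyclic -/

/-- Vanishing power moments force vanishing coefficients: if `a ∈ ℓ¹` and `Σ_k w_k^j a_k = 0` for every `j ≥ 0`
then `a = 0` (the weights are distinct and DECREASING, so after removing the first `m` coefficients the `m`-th
dominates: `|a_m| ≤ (w_{m+1}/w_m)^j ‖a‖₁ → 0`). [folklore] -/
theorem eq_zero_of_moments_eq_zero (a : ℕ → ℂ) (ha : Summable (fun k => ‖a k‖))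
    (hF : ∀ j : ℕ, ∑' k, ((wgt k : ℝ) : ℂ) ^ j * a k = 0) : ∀ k, a k = 0 := by
  classical
  by_contra hne
  push Not at hne
  let m := Nat.find hne
  have hm : a m ≠ 0 := Nat.find_spec hne
  have hlt : ∀ k < m, a k = 0 := fun k hk => by
    have h := Nat.find_min hne hk
    simpa using h
  set A := ∑' k, ‖a k‖ with hA
  have hA0 : 0 ≤ A := tsum_nonneg (fun k => norm_nonneg _)
  -- the key estimate: `w_m^j |a_m| ≤ w_{m+1}^j A` for every `j`
  have key : ∀ j : ℕ, wgt m ^ j * ‖a m‖ ≤ wgt (m + 1) ^ j * A := by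
    intro j
    let c : ℕ → ℂ := fun k => if k = m then 0 else ((wgt k : ℝ) : ℂ) ^ j * a k
    have hc_bound : ∀ k, ‖c k‖ ≤ wgt (m + 1) ^ j * ‖a k‖ := by
      intro k
      by_cases hkm : k = m
      · simp only [c, if_pos hkm, norm_zero]
        have := wgt_pos (m + 1)
        positivity
      · simp only [c, if_neg hkm]
        rcases lt_or_gt_of_ne hkm with hk | hk
        · rw [hlt k hk]; simp
        · rw [norm_mul, norm_pow, Complex.norm_real, Real.norm_of_nonneg (wgt_pos k).le]
          exact mul_le_mul_of_nonneg_right (pow_le_pow_left₀ (wgt_pos k).le (wgt_le_wgt_succ hk) j)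
            (norm_nonneg _)
    have hc_summ : Summable (fun k => ‖c k‖) :=
      Summable.of_nonneg_of_le (fun k => norm_nonneg _) hc_bound (ha.mul_left _)
    have hsplit : ∀ k, ((wgt k : ℝ) : ℂ) ^ j * a k
        = (if k = m then ((wgt m : ℝ) : ℂ) ^ j * a m else 0) + c k := by
      intro k
      by_cases hkm : k = m
      · subst hkm; simp [c]
      · simp [c, hkm]
    have hsum1 : Summable (fun k => if k = m then ((wgt m : ℝ) : ℂ) ^ j * a m else 0) :=
      summable_of_ne_finset_zero (s := {m}) (by intro k hk; rw [Finset.mem_singleton] at hk; rw [if_neg hk])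
    have hF' : (∑' k, ((if k = m then ((wgt m : ℝ) : ℂ) ^ j * a m else 0) + c k)) = 0 :=
      (tsum_congr (fun k => (hsplit k).symm)).trans (hF j)
    rw [hsum1.tsum_add hc_summ.of_norm, tsum_ite_eq] at hF'
    have h1 : ((wgt m : ℝ) : ℂ) ^ j * a m = -∑' k, c k := eq_neg_of_add_eq_zero_left hF'
    have h2 : ‖((wgt m : ℝ) : ℂ) ^ j * a m‖ ≤ ∑' k, ‖c k‖ := by
      rw [h1, norm_neg]; exact norm_tsum_le_tsum_norm hc_summ
    have h3 : ∑' k, ‖c k‖ ≤ ∑' k, wgt (m + 1) ^ j * ‖a k‖ :=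
      Summable.tsum_le_tsum hc_bound hc_summ (ha.mul_left _)
    rw [tsum_mul_left] at h3
    rw [norm_mul, norm_pow, Complex.norm_real, Real.norm_of_nonneg (wgt_pos m).le] at h2
    exact h2.trans h3
  -- conclusion: `|a_m| ≤ ρ^j (A+1)` with `ρ < 1`, for every `j`
  have hρ := wgt_succ_div_lt_one m
  have hpos : 0 < ‖a m‖ := norm_pos_iff.mpr hm
  have hA1 : 0 < A + 1 := by linarith
  obtain ⟨j, hj⟩ := exists_pow_lt_of_lt_one (div_pos hpos hA1) hρ
  have hk := key j
  have hwm : 0 < wgt m ^ j := pow_pos (wgt_pos m) j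
  have h4 : ‖a m‖ ≤ (wgt (m + 1) / wgt m) ^ j * A := by
    rw [div_pow, div_mul_eq_mul_div, le_div_iff₀ hwm]
    linarith
  have h5 : (wgt (m + 1) / wgt m) ^ j * A ≤ (wgt (m + 1) / wgt m) ^ j * (A + 1) := by
    have : 0 ≤ (wgt (m + 1) / wgt m) ^ j := pow_nonneg (div_pos (wgt_pos _) (wgt_pos _)).le j
    nlinarith
  have h6 : (wgt (m + 1) / wgt m) ^ j * (A + 1) < ‖a m‖ := by rwa [lt_div_iff₀ hA1] at hj
  linarith

/-- **Cyclicity criterion**: a vector of `ℓ²(ℕ)` all of whose coordinates are non-zero is CYCLIC for `D_c` — its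
orbit `{D_c^j f}_{j ≥ 0}` spans a dense subspace (a vector orthogonal to the orbit has vanishing weighted power
moments, hence vanishes). [folklore] -/
theorem orbitClosure_eq_top (f : ℓ2T) (hf : ∀ k, f k ≠ 0) : orbitClosure Dc f = ⊤ := by
  unfold orbitClosure
  rw [Submodule.topologicalClosure_eq_top_iff, Submodule.eq_bot_iff]
  intro v hv
  have hF : ∀ j : ℕ, ⟪(Dc ^ j) f, v⟫_ℂ = 0 := fun j => by
    have hu : (Dc ^ j) f ∈ Submodule.span ℂ (Set.range fun n : ℕ => (Dc ^ n) f) :=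
      Submodule.subset_span ⟨j, rfl⟩
    exact Submodule.inner_right_of_mem_orthogonal hu hv
  let a : ℕ → ℂ := fun k => conj (f k) * v k
  have ha : Summable (fun k => ‖a k‖) := by
    refine Summable.of_nonneg_of_le (fun k => norm_nonneg _) (fun k => ?_)
      (((summable_sq f).add (summable_sq v)).div_const 2)
    simp only [a, norm_mul, Complex.norm_conj]
    have := two_mul_le_add_sq ‖f k‖ ‖v k‖
    linarith
  have hmom : ∀ j : ℕ, ∑' k, ((wgt k : ℝ) : ℂ) ^ j * a k = 0 := by
    intro j
    rw [← hF j, lp.inner_eq_tsum]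
    refine tsum_congr (fun k => ?_)
    simp only [a]
    rw [RCLike.inner_apply', Dc_pow_apply, map_mul, map_pow, Complex.conj_ofReal]
    ring
  have hzero := eq_zero_of_moments_eq_zero a ha hmom
  apply lp.ext
  funext k
  have h := hzero k
  simp only [a, mul_eq_zero] at h
  rcases h with h | h
  · exact absurd ((map_eq_zero _).mp h) (hf k)
  · simpa using h

/-- Hence such a vector is not non-cyclic (in the vocabulary of `Basic.lean`). [folklore] -/
theorem not_isNonCyclic (f : ℓ2T) (hf : ∀ k, f k ≠ 0) : ¬ IsNonCyclic Dc f :=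
  fun h => h (orbitClosure_eq_top f hf)

/-! ### (4) The vectors: `y_k = (4/5)2^{-k}` (full support), `x₀ = y + u` with `u` on `e₀,…,e₃,e₃₀₀,e₃₀₁` -/

/-- The coordinates of `y`: `y_k = (4/5)·2^{-k}` — ALL non-zero. [cite: Enflo2023, v2 p.13, eq. (27)] -/
def yfun (k : ℕ) : ℝ := 4 / 5 / 2 ^ k

/-- `y_k ≠ 0`. [cite: Enflo2023, v2 p.13, eq. (27)] -/
lemma yfun_ne_zero (k : ℕ) : yfun k ≠ 0 := by unfold yfun; positivity

/-- `y_k > 0`. [cite: Enflo2023, v2 p.13, eq. (27)] -/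
lemma yfun_pos (k : ℕ) : 0 < yfun k := by unfold yfun; positivity

/-- `y_k² = (16/25)(1/4)^k`. [cite: Enflo2023, v2 p.13, eq. (27)] -/
lemma yfun_sq (k : ℕ) : yfun k ^ 2 = 16 / 25 * (1 / 4) ^ k := by
  unfold yfun
  have h : ((1 : ℝ) / 4) ^ k = 1 / (2 ^ k) ^ 2 := by
    rw [one_div_pow, ← pow_mul, mul_comm k 2, pow_mul]; norm_num
  rw [h, div_pow]
  ring

/-- `y ∈ ℓ²`. [cite: Enflo2023, v2 p.13, eq. (27)] -/
lemma memℓp_yfun : Memℓp (fun k => ((yfun k : ℝ) : ℂ)) 2 := by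
  rw [memℓp_gen_iff (by norm_num : 0 < (2 : ℝ≥0∞).toReal)]
  simp only [ENNReal.toReal_ofNat, Real.rpow_two, Complex.norm_real, Real.norm_eq_abs, sq_abs, yfun_sq]
  exact (summable_geometric_of_lt_one (by norm_num) (by norm_num)).mul_left _

/-- **`y`** `= Σ_k (4/5)2^{-k} e_k ∈ ℓ²(ℕ)`. [cite: Enflo2023, v2 p.13, eq. (27)] -/
def yC : ℓ2T := ⟨fun k => ((yfun k : ℝ) : ℂ), memℓp_yfun⟩

/-- Coordinates of `y`. [cite: Enflo2023, v2 p.13, eq. (27)] -/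
@[simp] lemma yC_apply (k : ℕ) : yC k = ((yfun k : ℝ) : ℂ) := rfl

/-- `‖y_k‖² = (16/25)(1/4)^k`. [cite: Enflo2023, v2 p.13, eq. (27)] -/
lemma norm_sq_yC_apply (k : ℕ) : ‖yC k‖ ^ 2 = 16 / 25 * (1 / 4) ^ k := by
  rw [yC_apply, Complex.norm_real, Real.norm_eq_abs, sq_abs, yfun_sq]

/-- `‖y‖² = (16/25)·Σ(1/4)^k = 64/75`. [cite: Enflo2023, v2 p.13, eq. (27)] -/
lemma norm_sq_yC : ‖yC‖ ^ 2 = 64 / 75 := by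
  have h := lp.norm_rpow_eq_tsum (by norm_num : 0 < (2 : ℝ≥0∞).toReal) yC
  simp only [ENNReal.toReal_ofNat, Real.rpow_two] at h
  rw [h]
  simp only [norm_sq_yC_apply]
  rw [tsum_mul_left, tsum_geometric_of_lt_one (by norm_num) (by norm_num)]
  norm_num

/-- `‖y‖ ≤ 1`. [cite: Enflo2023, v2 p.13, eq. (27)] -/
lemma norm_yC_le_one : ‖yC‖ ≤ 1 := by
  have h : ‖yC‖ ^ 2 ≤ 1 := by rw [norm_sq_yC]; norm_num
  exact (pow_le_one_iff_of_nonneg (norm_nonneg _) two_ne_zero).1 h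

/-- `y ≠ 0`. [cite: Enflo2023, v2 p.13, eq. (27)] -/
lemma yC_ne_zero : yC ≠ 0 := by
  intro h; have := norm_sq_yC; rw [h, norm_zero] at this; norm_num at this

/-- `y` lies in the Type-1 cone of `u₀ = e₀`: `Re⟨e₀, y⟩ = 4/5 ≥ ‖y‖/100`. [cite: Enflo2023, v2 p.6] -/
lemma angleCond_yC : Referee.AngleCond (lp.single 2 0 (1 : ℂ) : ℓ2T) yC := by
  refine ⟨yC_ne_zero, ?_⟩
  rw [lp.inner_single_left, RCLike.inner_apply', map_one, one_mul, yC_apply, Complex.ofReal_re]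
  unfold yfun
  have := norm_yC_le_one
  norm_num
  linarith

/-- The radicand of the bulk coordinate: `(1 − ‖y‖² − 2εθ − γ'(εθ)²)/5 = (11/75 − 2εθ − γ'(εθ)²)/5`,
`γ' = 9235625/576 ≈ 1.6·10⁴` (`= Σ_{i<4}(cᵢ/yᵢ)²`). [cite: Enflo2023, v2 p.13, eq. (27)] -/
def radC (et : ℝ) : ℝ := (11 / 75 - 2 * et - 9235625 / 576 * et ^ 2) / 5

/-- The radicand is positive for `0 < εθ ≤ 10⁻²³`. [cite: Enflo2023, v2 p.13, eq. (27)] -/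
lemma radC_pos {et : ℝ} (het0 : 0 < et) (het2 : et ≤ 1 / 10 ^ 23) : 0 < radC et := by
  unfold radC
  have h2 : et ^ 2 ≤ (1 / 10 ^ 23) ^ 2 := pow_le_pow_left₀ het0.le het2 2
  nlinarith

/-- A lower bound: `radC ≥ 1/40` (so `s ≥ 0.158`). [cite: Enflo2023, v2 p.13, eq. (27)] -/
lemma radC_ge {et : ℝ} (het0 : 0 < et) (het2 : et ≤ 1 / 10 ^ 23) : 1 / 40 ≤ radC et := by
  unfold radC
  have h2 : et ^ 2 ≤ (1 / 10 ^ 23) ^ 2 := pow_le_pow_left₀ het0.le het2 2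
  nlinarith

/-- An upper bound: `radC ≤ 3/100`. [cite: Enflo2023, v2 p.13, eq. (27)] -/
lemma radC_le {et : ℝ} (het0 : 0 < et) : radC et ≤ 3 / 100 := by
  unfold radC; nlinarith [sq_nonneg et]

/-- The bulk coordinate `s = radC^{1/2}` (it makes `‖x₀‖ = 1` exact). [cite: Enflo2023, v2 p.13, eq. (27)] -/
def sC (et : ℝ) : ℝ := Real.sqrt (radC et)

/-- `s ≥ 0`. [cite: Enflo2023, v2 p.13, eq. (27)] -/
lemma sC_nonneg (et : ℝ) : 0 ≤ sC et := Real.sqrt_nonneg _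

/-- `s² = radC`. [cite: Enflo2023, v2 p.13, eq. (27)] -/
lemma sC_sq {et : ℝ} (het0 : 0 < et) (het2 : et ≤ 1 / 10 ^ 23) : sC et ^ 2 = radC et :=
  Real.sq_sqrt (radC_pos het0 het2).le

/-- `s ≤ 1`. [cite: Enflo2023, v2 p.13, eq. (27)] -/
lemma sC_le_one {et : ℝ} (het0 : 0 < et) (het2 : et ≤ 1 / 10 ^ 23) : sC et ≤ 1 := by
  have h := sC_sq het0 het2
  have h1 := radC_le (et := et) het0
  have h0 := sC_nonneg et
  nlinarith

/-- `s > 1/10`. [cite: Enflo2023, v2 p.13, eq. (27)] -/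
lemma sC_gt {et : ℝ} (het0 : 0 < et) (het2 : et ≤ 1 / 10 ^ 23) : 1 / 10 < sC et := by
  have h := sC_sq het0 het2
  have h1 := radC_ge het0 het2
  have h0 := sC_nonneg et
  nlinarith

/-- The coordinates of `u = x₀ − y`: `εθ·(cᵢ/yᵢ)` on the nodes `k = 0,…,3` — `c = (−1/6, 4, −27/2, 32/3)` the
Lagrange weights of the nodes `(1, 1/2, 1/3, 1/4)` at `0` — and the bulk `s(e₃₀₀ − 2e₃₀₁)` (orthogonal to `y`).
[cite: Enflo2023, v2 p.13, eq. (27)] -/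
def ufun (et : ℝ) (k : ℕ) : ℝ :=
  if k = 0 then -(5 * et / 24) else if k = 1 then 10 * et else if k = 2 then -(135 * et / 2)
  else if k = 3 then 320 * et / 3 else if k = 300 then sC et else if k = 301 then -(2 * sC et) else 0

/-- The support of `u`. [cite: Enflo2023, v2 p.13, eq. (27)] -/
def S : Finset ℕ := {0, 1, 2, 3, 300, 301}

/-- `u` vanishes off its support. [cite: Enflo2023, v2 p.13, eq. (27)] -/
lemma ufun_eq_zero {et : ℝ} {k : ℕ} (hk : k ∉ S) : ufun et k = 0 := by
  simp only [S, Finset.mem_insert, Finset.mem_singleton, not_or] at hk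
  obtain ⟨h0, h1, h2, h3, h300, h301⟩ := hk
  simp [ufun, h0, h1, h2, h3, h300, h301]

/-- `u ∈ ℓ²` (finite support). [cite: Enflo2023, v2 p.13, eq. (27)] -/
lemma memℓp_ufun (et : ℝ) : Memℓp (fun k => ((ufun et k : ℝ) : ℂ)) 2 := by
  rw [memℓp_gen_iff (by norm_num : 0 < (2 : ℝ≥0∞).toReal)]
  refine summable_of_ne_finset_zero (s := S) (fun k hk => ?_)
  simp [ufun_eq_zero hk]

/-- **`u = x₀ − y`** `∈ ℓ²(ℕ)`. [cite: Enflo2023, v2 p.13, eq. (27)] -/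
def uC (et : ℝ) : ℓ2T := ⟨fun k => ((ufun et k : ℝ) : ℂ), memℓp_ufun et⟩

/-- Coordinates of `u`. [cite: Enflo2023, v2 p.13, eq. (27)] -/
@[simp] lemma uC_apply (et : ℝ) (k : ℕ) : uC et k = ((ufun et k : ℝ) : ℂ) := rfl

/-- **`x₀`** `= y + u`. [cite: Enflo2023, v2 p.13, eq. (27)] -/
def x0C (et : ℝ) : ℓ2T := yC + uC et

/-- `x₀ − y = u`. [cite: Enflo2023, v2 p.13, eq. (27)] -/
lemma x0C_sub_yC (et : ℝ) : x0C et - yC = uC et := by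
  unfold x0C; exact add_sub_cancel_left _ _

/-- Coordinates of `x₀`. [cite: Enflo2023, v2 p.13, eq. (27)] -/
lemma x0C_apply (et : ℝ) (k : ℕ) : x0C et k = ((yfun k + ufun et k : ℝ) : ℂ) := by
  unfold x0C
  rw [lp.coeFn_add, Pi.add_apply, yC_apply, uC_apply]
  push_cast
  rfl

/-- ALL coordinates of `x₀` are non-zero (so `x₀`, like `y`, is cyclic for `D_c`). [cite: Enflo2023, v2 p.13, eq. (27)] -/
lemma x0fun_ne_zero {et : ℝ} (het0 : 0 < et) (het2 : et ≤ 1 / 10 ^ 23) (k : ℕ) :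
    yfun k + ufun et k ≠ 0 := by
  have hs0 := sC_nonneg et
  have hs1 := sC_gt het0 het2
  have hy := yfun_pos k
  by_cases hk : k ∈ S
  · simp only [S, Finset.mem_insert, Finset.mem_singleton] at hk
    rcases hk with rfl | rfl | rfl | rfl | rfl | rfl
    · refine (?_ : (0 : ℝ) < _).ne'
      simp [yfun, ufun]; nlinarith
    · refine (?_ : (0 : ℝ) < _).ne'
      simp [yfun, ufun]; nlinarith
    · refine (?_ : (0 : ℝ) < _).ne'
      simp [yfun, ufun]; nlinarith
    · refine (?_ : (0 : ℝ) < _).ne'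
      simp [yfun, ufun]; nlinarith
    · refine (?_ : (0 : ℝ) < _).ne'
      simp [yfun, ufun]
      have h300 : (0 : ℝ) < 4 / 5 / 2 ^ 300 := by positivity
      linarith
    · refine (?_ : _ < (0 : ℝ)).ne
      simp [yfun, ufun]
      norm_num
      nlinarith
  · rw [ufun_eq_zero hk, add_zero]; exact hy.ne'

/-- `y` is cyclic for `D_c`. [cite: Enflo2023, v2 p.13, eq. (27)] -/
theorem yC_cyclic : ¬ IsNonCyclic Dc yC :=
  not_isNonCyclic yC (fun k => by rw [yC_apply]; exact Complex.ofReal_ne_zero.mpr (yfun_ne_zero k))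

/-- `x₀` is cyclic for `D_c`. [cite: Enflo2023, v2 p.13, eq. (27)] -/
theorem x0C_cyclic {et : ℝ} (het0 : 0 < et) (het2 : et ≤ 1 / 10 ^ 23) : ¬ IsNonCyclic Dc (x0C et) :=
  not_isNonCyclic (x0C et) (fun k => by
    rw [x0C_apply]; exact Complex.ofReal_ne_zero.mpr (x0fun_ne_zero het0 het2 k))

/-! ### (5) The numbers: `‖x₀‖ = 1`, `⟨y, x₀ − y⟩ = εθ`, the window, Case II for all `j`, generic position -/

/-- Inner products against the finitely supported `u` are finite sums over its support. [folklore] -/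
lemma inner_uC_eq_sum (et : ℝ) (g : ℓ2T) :
    ⟪uC et, g⟫_ℂ = ∑ k ∈ S, ((ufun et k : ℝ) : ℂ) * g k := by
  rw [lp.inner_eq_tsum]
  have h : ∀ k, ⟪uC et k, g k⟫_ℂ = ((ufun et k : ℝ) : ℂ) * g k := fun k => by
    rw [RCLike.inner_apply', uC_apply, Complex.conj_ofReal]
  simp only [h]
  exact tsum_eq_sum (fun k hk => by rw [ufun_eq_zero hk]; simp)

/-- `⟨y, x₀ − y⟩ = ⟨y, u⟩ = εθ` EXACTLY (the Lagrange weights sum to `1`; the bulk is orthogonal to `y`: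
`s·y₃₀₀ − 2s·y₃₀₁ = 0`). [cite: Enflo2023, v2 p.13, eq. (26)] -/
lemma inner_uC_yC (et : ℝ) : ⟪uC et, yC⟫_ℂ = ((et : ℝ) : ℂ) := by
  rw [inner_uC_eq_sum]
  simp only [yC_apply, ← Complex.ofReal_mul, ← Complex.ofReal_sum]
  congr 1
  simp [S, Finset.sum_insert, ufun, yfun]
  ring

/-- `⟨y, x₀ − y⟩ = εθ`. [cite: Enflo2023, v2 p.13, eq. (26)] -/
lemma inner_x0C_sub_yC_yC (et : ℝ) : ⟪x0C et - yC, yC⟫_ℂ = ((et : ℝ) : ℂ) := by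
  rw [x0C_sub_yC, inner_uC_yC]

/-- `‖u‖² = γ'(εθ)² + 5s² = 11/75 − 2εθ`. [cite: Enflo2023, v2 p.13, eq. (26)] -/
lemma norm_sq_uC {et : ℝ} (het0 : 0 < et) (het2 : et ≤ 1 / 10 ^ 23) : ‖uC et‖ ^ 2 = 11 / 75 - 2 * et := by
  have h := inner_uC_eq_sum et (uC et)
  rw [inner_self_eq_coe_norm_sq] at h
  simp only [uC_apply, ← Complex.ofReal_mul, ← Complex.ofReal_sum] at h
  rw [Complex.ofReal_injective h]
  simp [S, Finset.sum_insert, ufun]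
  have hs := sC_sq het0 het2
  unfold radC at hs
  nlinarith [hs]

/-- `‖x₀‖² = ‖y‖² + 2εθ + ‖u‖² = 1`. [cite: Enflo2023, v2 p.13, eq. (26)] -/
lemma norm_sq_x0C {et : ℝ} (het0 : 0 < et) (het2 : et ≤ 1 / 10 ^ 23) : ‖x0C et‖ ^ 2 = 1 := by
  unfold x0C
  rw [norm_add_sq (𝕜 := ℂ), norm_sq_yC, norm_sq_uC het0 het2, ← inner_conj_symm, inner_uC_yC,
    Complex.conj_ofReal]
  simp only [RCLike.re_to_complex, Complex.ofReal_re]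
  ring

/-- `‖x₀‖ = 1`. [cite: Enflo2023, v2 p.13, eq. (26)] -/
lemma norm_x0C {et : ℝ} (het0 : 0 < et) (het2 : et ≤ 1 / 10 ^ 23) : ‖x0C et‖ = 1 := by
  have h := norm_sq_x0C het0 het2
  have h0 : 0 ≤ ‖x0C et‖ := norm_nonneg _
  nlinarith

/-- The distance window: `0.3 ≤ ‖x₀ − y‖ ≤ 0.5` (`‖x₀ − y‖ = (11/75 − 2εθ)^{1/2} ≈ 0.383`, inside Lemma 1's
`(0.3, 0.5]`). [cite: Enflo2023, v2 p.10, Lemma 1] -/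
lemma windowC {et : ℝ} (het0 : 0 < et) (het2 : et ≤ 1 / 10 ^ 23) :
    (0.3 : ℝ) ≤ ‖x0C et - yC‖ ∧ ‖x0C et - yC‖ ≤ 0.5 := by
  rw [x0C_sub_yC]
  have h := norm_sq_uC het0 het2
  have h0 : 0 ≤ ‖uC et‖ := norm_nonneg _
  constructor <;> nlinarith

/-- The radius of (26): `ε' = ‖x₀ − (1+δ)y‖ < 1`. [cite: Enflo2023, v2 p.13, eq. (26)] -/
lemma radiusC_lt_one {et : ℝ} (het0 : 0 < et) (het2 : et ≤ 1 / 10 ^ 23) :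
    ‖x0C et - ((1 + et / 10 : ℝ) : ℂ) • yC‖ < 1 := by
  have hyle := norm_yC_le_one
  obtain ⟨-, hρ2⟩ := windowC het0 het2
  have hsplit : x0C et - ((1 + et / 10 : ℝ) : ℂ) • yC = (x0C et - yC) - ((et / 10 : ℝ) : ℂ) • yC := by
    push_cast
    rw [add_smul, one_smul]
    abel
  rw [hsplit]
  calc ‖(x0C et - yC) - ((et / 10 : ℝ) : ℂ) • yC‖ ≤ ‖x0C et - yC‖ + ‖((et / 10 : ℝ) : ℂ) • yC‖ :=
        norm_sub_le _ _
    _ ≤ 0.5 + et / 10 * 1 := by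
        rw [norm_smul, Complex.norm_real, Real.norm_of_nonneg (by linarith)]
        gcongr
    _ < 1 := by linarith

/-- The Case II bracket `Σᵢ cᵢ (λrᵢ)^j` for the nodes `r = (1, 1/2, 1/3, 1/4)` VANISHES for `j = 1, 2, 3`
(Lagrange weights `c = (−1/6, 4, −27/2, 32/3)`). [cite: Enflo2023, v2 p.13, Case II] -/
lemma bracketC_zero_of_le_three (j : ℕ) (hj1 : 1 ≤ j) (hj3 : j ≤ 3) :
    (-(1 / 6) * lam ^ j + 4 * (lam / 2) ^ j - 27 / 2 * (lam / 3) ^ j + 32 / 3 * (lam / 4) ^ j : ℝ) = 0 := by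
  interval_cases j <;> ring

/-- The Case II bracket is `≤ (Σ|cᵢ|)λ⁴ = (85/3)λ⁴` in absolute value for `j ≥ 4`. [cite: Enflo2023, v2 p.13, Case II] -/
lemma bracketC_abs_le (j : ℕ) (hj : 4 ≤ j) :
    |(-(1 / 6) * lam ^ j + 4 * (lam / 2) ^ j - 27 / 2 * (lam / 3) ^ j + 32 / 3 * (lam / 4) ^ j : ℝ)|
      ≤ 85 / 3 * lam ^ 4 := by
  have hl0 : 0 ≤ lam := lam_pos_le.1.le
  have hl1 : lam ≤ 1 := by rw [lam_def]; norm_num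
  have h4 : lam ^ j ≤ lam ^ 4 := pow_le_pow_of_le_one hl0 hl1 hj
  have hp : ∀ c : ℝ, 1 ≤ c → 0 ≤ (lam / c) ^ j ∧ (lam / c) ^ j ≤ lam ^ 4 := by
    intro c hc
    have h0 : 0 ≤ lam / c := div_nonneg hl0 (by linarith)
    have h1 : lam / c ≤ lam := div_le_self hl0 hc
    exact ⟨pow_nonneg h0 j, (pow_le_pow_left₀ h0 h1 j).trans h4⟩
  obtain ⟨h20, h21⟩ := hp 2 (by norm_num)
  obtain ⟨h30, h31⟩ := hp 3 (by norm_num)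
  obtain ⟨h40, h41⟩ := hp 4 (by norm_num)
  have h10 : 0 ≤ lam ^ j := pow_nonneg hl0 j
  rw [abs_le]; constructor <;> nlinarith

/-- Case II in coordinates: `⟨D_c^j y, x₀ − y⟩ = εθ·(bracket) + s·y₃₀₀·w₃₀₀^j − 2s·y₃₀₁·w₃₀₁^j`.
[cite: Enflo2023, v2 p.13, Case II] -/
lemma inner_uC_Dcpow_yC (et : ℝ) (j : ℕ) :
    ⟪uC et, (Dc ^ j) yC⟫_ℂ
      = ((et * (-(1 / 6) * lam ^ j + 4 * (lam / 2) ^ j - 27 / 2 * (lam / 3) ^ j + 32 / 3 * (lam / 4) ^ j)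
          + sC et * (4 / 5 / 2 ^ 300) * (lam / 301) ^ j
          - 2 * sC et * (4 / 5 / 2 ^ 301) * (lam / 302) ^ j : ℝ) : ℂ) := by
  rw [inner_uC_eq_sum]
  simp only [Dc_pow_apply, yC_apply, ← Complex.ofReal_pow, ← Complex.ofReal_mul, ← Complex.ofReal_sum]
  congr 1
  simp [S, Finset.sum_insert, ufun, yfun, wgt]
  norm_num
  ring

/-- The bulk part of the Case II bracket is `≤ λ/2²⁹⁵` in absolute value. [cite: Enflo2023, v2 p.13, Case II] -/
lemma bulk_abs_le {et : ℝ} (het0 : 0 < et) (het2 : et ≤ 1 / 10 ^ 23) (j : ℕ) (hj : 1 ≤ j) :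
    |sC et * (4 / 5 / 2 ^ 300) * (lam / 301) ^ j - 2 * sC et * (4 / 5 / 2 ^ 301) * (lam / 302) ^ j|
      ≤ lam / 2 ^ 295 := by
  have hs0 := sC_nonneg et
  have hs1 := sC_le_one het0 het2
  have hl0 : 0 ≤ lam := lam_pos_le.1.le
  have hl1 : lam ≤ 1 := by rw [lam_def]; norm_num
  have hp : ∀ c : ℝ, 1 ≤ c → 0 ≤ (lam / c) ^ j ∧ (lam / c) ^ j ≤ lam := by
    intro c hc
    have h0 : 0 ≤ lam / c := div_nonneg hl0 (by linarith)
    have h1 : lam / c ≤ lam := div_le_self hl0 hc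
    refine ⟨pow_nonneg h0 j, (pow_le_pow_left₀ h0 h1 j).trans ?_⟩
    calc lam ^ j ≤ lam ^ 1 := pow_le_pow_of_le_one hl0 hl1 hj
      _ = lam := pow_one lam
  obtain ⟨h1, h2⟩ := hp 301 (by norm_num)
  obtain ⟨h3, h4⟩ := hp 302 (by norm_num)
  have h5 : (4 / 5 / 2 ^ 300 : ℝ) ≤ 1 / 2 ^ 297 := by
    rw [div_le_div_iff₀ (by positivity) (by positivity)]; norm_num
  have h6 : (4 / 5 / 2 ^ 301 : ℝ) ≤ 1 / 2 ^ 298 := by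
    rw [div_le_div_iff₀ (by positivity) (by positivity)]; norm_num
  have h7 : (0 : ℝ) ≤ 4 / 5 / 2 ^ 300 := by positivity
  have h8 : (0 : ℝ) ≤ 4 / 5 / 2 ^ 301 := by positivity
  rw [abs_le]
  constructor
  · have : 2 * sC et * (4 / 5 / 2 ^ 301) * (lam / 302) ^ j ≤ 2 * 1 * (1 / 2 ^ 298) * lam := by
      gcongr
    have hA : 0 ≤ sC et * (4 / 5 / 2 ^ 300) * (lam / 301) ^ j := by positivity
    have hB : (2 * 1 * (1 / 2 ^ 298) * lam : ℝ) ≤ lam / 2 ^ 295 := by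
      rw [show (2 * 1 * (1 / 2 ^ 298) * lam : ℝ) = lam / 2 ^ 297 by ring]
      exact div_le_div_of_nonneg_left hl0 (by positivity) (by norm_num)
    linarith
  · have : sC et * (4 / 5 / 2 ^ 300) * (lam / 301) ^ j ≤ 1 * (1 / 2 ^ 297) * lam := by
      gcongr
    have hA : 0 ≤ 2 * sC et * (4 / 5 / 2 ^ 301) * (lam / 302) ^ j := by positivity
    have hB : (1 * (1 / 2 ^ 297) * lam : ℝ) ≤ lam / 2 ^ 295 := by
      rw [show (1 * (1 / 2 ^ 297) * lam : ℝ) = lam / 2 ^ 297 by ring]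
      exact div_le_div_of_nonneg_left hl0 (by positivity) (by norm_num)
    linarith

/-- **Case II holds for EVERY `j ≥ 1`, strictly**: `|⟨D_c^j y, x₀ − y⟩| < (εθ)⁴` — the node part is `0` for
`j ≤ 3` and `≤ (85/3)·10⁻⁸⁰·εθ` for `j ≥ 4` (this is where `εθ ≥ 10⁻²⁶` is used); the bulk part is `≤ 10⁻²⁰/2²⁹⁵`.
[cite: Enflo2023, v2 p.13, Case II] -/
lemma caseIIC_all {et : ℝ} (het1 : 1 / 10 ^ 26 ≤ et) (het2 : et ≤ 1 / 10 ^ 23) (j : ℕ) (hj : 1 ≤ j) :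
    ‖⟪x0C et - yC, (Dc ^ j) yC⟫_ℂ‖ < et ^ 4 := by
  have het0 : 0 < et := lt_of_lt_of_le (by norm_num) het1
  rw [x0C_sub_yC, inner_uC_Dcpow_yC, Complex.norm_real, Real.norm_eq_abs]
  have hbulk := bulk_abs_le het0 het2 j hj
  have h4 : (1 / 10 ^ 26 : ℝ) ^ 4 ≤ et ^ 4 := pow_le_pow_left₀ (by norm_num) het1 4
  have hsmall : lam / 2 ^ 295 < (1 / 10 ^ 26 : ℝ) ^ 4 := by rw [lam_def]; norm_num
  set B := sC et * (4 / 5 / 2 ^ 300) * (lam / 301) ^ j - 2 * sC et * (4 / 5 / 2 ^ 301) * (lam / 302) ^ j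
    with hB
  set N := (-(1 / 6) * lam ^ j + 4 * (lam / 2) ^ j - 27 / 2 * (lam / 3) ^ j + 32 / 3 * (lam / 4) ^ j : ℝ)
    with hN
  have htri : |et * N + B| ≤ et * |N| + |B| := by
    calc |et * N + B| ≤ |et * N| + |B| := abs_add_le _ _
      _ = et * |N| + |B| := by rw [abs_mul, abs_of_pos het0]
  have heq : et * N + sC et * (4 / 5 / 2 ^ 300) * (lam / 301) ^ j
      - 2 * sC et * (4 / 5 / 2 ^ 301) * (lam / 302) ^ j = et * N + B := by rw [hB]; ring
  rw [heq]
  by_cases h3 : j ≤ 3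
  · rw [hN, bracketC_zero_of_le_three j hj h3] at htri
    rw [hN, bracketC_zero_of_le_three j hj h3]
    simp only [abs_zero, mul_zero, zero_add] at htri ⊢
    linarith
  · push Not at h3
    have hb : |N| ≤ 85 / 3 * lam ^ 4 := by rw [hN]; exact bracketC_abs_le j h3
    have h3' : (1 / 10 ^ 26 : ℝ) ^ 3 ≤ et ^ 3 := pow_le_pow_left₀ (by norm_num) het1 3
    have hA : 85 / 3 * lam ^ 4 + lam / 2 ^ 295 * 10 ^ 26 < (1 / 10 ^ 26 : ℝ) ^ 3 := by
      rw [lam_def]; norm_num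
    have h26 : 1 ≤ et * 10 ^ 26 := by
      have := mul_le_mul_of_nonneg_right het1 (by norm_num : (0 : ℝ) ≤ 10 ^ 26)
      simpa using this
    have hl0 : 0 ≤ lam / 2 ^ 295 := by have := lam_pos_le.1; positivity
    calc |et * N + B| ≤ et * |N| + |B| := htri
      _ ≤ et * (85 / 3 * lam ^ 4) + lam / 2 ^ 295 := by gcongr
      _ ≤ et * (85 / 3 * lam ^ 4) + lam / 2 ^ 295 * (et * 10 ^ 26) := by nlinarith
      _ = et * (85 / 3 * lam ^ 4 + lam / 2 ^ 295 * 10 ^ 26) := by ring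
      _ < et * et ^ 3 := by
          apply mul_lt_mul_of_pos_left _ het0
          exact hA.trans_le h3'
      _ = et ^ 4 := by ring

/-- Case II at `j = 1`, in the form `eq27_false_for_minimal` takes it. [cite: Enflo2023, v2 p.13, Case II] -/
lemma caseIIC_one {et : ℝ} (het1 : 1 / 10 ^ 26 ≤ et) (het2 : et ≤ 1 / 10 ^ 23) :
    ‖⟪x0C et - yC, Dc yC⟫_ℂ‖ ≤ et ^ 4 := by
  have h := caseIIC_all het1 het2 1 le_rfl
  rw [pow_one] at h
  exact h.le

/-- `⟨y, D_c y⟩` is real, `= Σ_k w_k y_k² ≥ Σ_{k<3} = (11/15)λ`. [cite: Enflo2023, v2 p.13, eq. (27)] -/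
lemma inner_yC_DcyC_ge : 11 / 15 * lam ≤ ∑' k, wgt k * ‖yC k‖ ^ 2 := by
  have hs := summable_wgt_pow_mul_sq 1 yC
  simp only [pow_one] at hs
  have h := hs.sum_le_tsum (Finset.range 3) (fun k _ => by have := wgt_pos k; positivity)
  refine le_trans (le_of_eq ?_) h
  simp [Finset.sum_range_succ, wgt, yfun]
  ring

/-- The generic-position bound `|⟨y, D_c y⟩| ≥ 10⁻²¹` (`≥ 0.73·10⁻²⁰`). [cite: Enflo2023, v2 p.13, eq. (27)] -/
lemma kappaC : 1 / 10 ^ 21 ≤ ‖⟪yC, Dc yC⟫_ℂ‖ := by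
  rw [inner_self_Dc, Complex.norm_real, Real.norm_of_nonneg
    (tsum_nonneg (fun k => by have := wgt_pos k; positivity))]
  have h := inner_yC_DcyC_ge
  rw [lam_def] at h
  linarith

/-- The generic-position bound `dist(D_c y, ℂy) ≥ 10⁻²¹`, read off the coordinate `k = 1`:
`|y₁|·|w₁ − ⟨y,D_c y⟩/‖y‖²| ≥ (2/5)(55/64 − 1/2)λ = (23/160)λ`. [cite: Enflo2023, v2 p.13, eq. (27)] -/
lemma tauC : 1 / 10 ^ 21 ≤ ‖Dc yC - (⟪yC, Dc yC⟫_ℂ / ((‖yC‖ ^ 2 : ℝ) : ℂ)) • yC‖ := by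
  set K := ∑' k, wgt k * ‖yC k‖ ^ 2 with hK
  have hKge : 11 / 15 * lam ≤ K := inner_yC_DcyC_ge
  have hcoord : ‖(Dc yC - (⟪yC, Dc yC⟫_ℂ / ((‖yC‖ ^ 2 : ℝ) : ℂ)) • yC) 1‖
      ≤ ‖Dc yC - (⟪yC, Dc yC⟫_ℂ / ((‖yC‖ ^ 2 : ℝ) : ℂ)) • yC‖ := lp.norm_apply_le_norm (by norm_num) _ 1
  refine le_trans ?_ hcoord
  rw [lp.coeFn_sub, Pi.sub_apply, lp.coeFn_smul, Pi.smul_apply, Dc_apply, yC_apply, inner_self_Dc, ← hK,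
    norm_sq_yC, smul_eq_mul, ← Complex.ofReal_div, ← Complex.ofReal_mul, ← Complex.ofReal_mul,
    ← Complex.ofReal_sub, Complex.norm_real, Real.norm_eq_abs]
  unfold yfun wgt
  rw [lam_def] at hKge ⊢
  rw [abs_sub_comm, abs_of_nonneg] <;> norm_num <;> nlinarith [hKge]

variable {et : ℝ}

/-- **Problem (26) has a minimal solution, and (27) fails for it** (operator `D_c`, cyclic `y`): for every
`εθ ∈ [10⁻²⁶, 10⁻²³]`, problem (1) for `V_y` at `ε' = ‖x₀ − (1+δ)y‖` has a norm-minimal solution `a ∈ ℓ²`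
(`(1+δ)e₀` is feasible, `ℓ²` complete), and its move is `≥ (εθ)²` (`eq27_false_for_minimal`).
[cite: Enflo2023, v2 p.13, eq. (26)–(27)] -/
theorem exists_minimal_and_eq27_false (het1 : 1 / 10 ^ 26 ≤ et) (het2 : et ≤ 1 / 10 ^ 23) :
    ∃ a : Vy.ℓ2,
      IsMinimal (Vy.V Dc norm_Dc_lt_one yC) (x0C et) ‖x0C et - ((1 + et / 10 : ℝ) : ℂ) • yC‖ a ∧
      et ^ 2 ≤ ‖Vy.V Dc norm_Dc_lt_one yC a - ((1 + et / 10 : ℝ) : ℂ) • yC‖ := by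
  have het0 : 0 < et := lt_of_lt_of_le (by norm_num) het1
  have hfeas : ((((1 + et / 10 : ℝ) : ℂ)) • (lp.single 2 0 (1 : ℂ) : Vy.ℓ2)) ∈
      feasible (Vy.V Dc norm_Dc_lt_one yC) (x0C et) ‖x0C et - ((1 + et / 10 : ℝ) : ℂ) • yC‖ := by
    rw [mem_feasible, Vy.V_smul_single_zero]
  obtain ⟨a, ha⟩ := exists_isMinimal _ _ _ ⟨_, hfeas⟩
  obtain ⟨hρ1, hρ2⟩ := windowC het0 het2
  exact ⟨a, ha, eq27_false_for_minimal Dc norm_Dc_lt_one norm_Dc_le (x0C et) yC et _ a (norm_x0C het0 het2)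
    (inner_x0C_sub_yC_yC et) (het1.trans' (by norm_num)) het2 hρ1 (hρ2.trans (by norm_num))
    (caseIIC_one het1 het2) kappaC tauC ha (radiusC_lt_one het0 het2) le_rfl⟩

/-- **The `ℓ²(ℕ)` model with cyclic vectors at parameter `εθ ∈ [10⁻²⁶, 10⁻²³]`**: every hypothesis of
`Eq27InferenceCyc` about the data holds (with the tighter window `≤ 0.5` and Case II for all `j ≥ 1`), `y` and `x₀`
are cyclic for `D_c`, the generic-position bounds hold, (26) has a minimal solution `a`, and its move is `≥ (εθ)²`.
[cite: Enflo2023, v2 p.13, eq. (26)–(27)] -/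
theorem facts (het1 : 1 / 10 ^ 26 ≤ et) (het2 : et ≤ 1 / 10 ^ 23) :
    ∃ a : Vy.ℓ2,
      IsMinimal (Vy.V Dc norm_Dc_lt_one yC) (x0C et) ‖x0C et - ((1 + et / 10 : ℝ) : ℂ) • yC‖ a ∧
      ‖x0C et‖ = 1 ∧ ⟪x0C et - yC, yC⟫_ℂ = (et : ℂ) ∧
      ((0.3 : ℝ) ≤ ‖x0C et - yC‖ ∧ ‖x0C et - yC‖ ≤ 0.5) ∧
      (∀ j : ℕ, 1 ≤ j → ‖⟪x0C et - yC, (Dc ^ j) yC⟫_ℂ‖ < et ^ 4) ∧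
      1 / 10 ^ 21 ≤ ‖⟪yC, Dc yC⟫_ℂ‖ ∧
      1 / 10 ^ 21 ≤ ‖Dc yC - (⟪yC, Dc yC⟫_ℂ / ((‖yC‖ ^ 2 : ℝ) : ℂ)) • yC‖ ∧
      ‖x0C et - ((1 + et / 10 : ℝ) : ℂ) • yC‖ < 1 ∧
      Referee.AngleCond (lp.single 2 0 (1 : ℂ) : ℓ2T) yC ∧
      ¬ IsNonCyclic Dc yC ∧ ¬ IsNonCyclic Dc (x0C et) ∧
      et ^ 2 ≤ ‖Vy.V Dc norm_Dc_lt_one yC a - ((1 + et / 10 : ℝ) : ℂ) • yC‖ := by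
  have het0 : 0 < et := lt_of_lt_of_le (by norm_num) het1
  obtain ⟨a, ha, hmove⟩ := exists_minimal_and_eq27_false het1 het2
  exact ⟨a, ha, norm_x0C het0 het2, inner_x0C_sub_yC_yC et, windowC het0 het2, caseIIC_all het1 het2, kappaC,
    tauC, radiusC_lt_one het0 het2, angleCond_yC, yC_cyclic, x0C_cyclic het0 het2, hmove⟩

end ModelC

open RoomModelT (ℓ2T)
open ModelC (Dc Dc_injective Dc_not_surjective Dc_denseRange Dc_isSelfAdjoint zero_mem_spectrum_Dc norm_Dc)

/-- **Satisfiability on `ℓ²(ℕ)` with every standing hypothesis AND cyclic `y`, `x₀`, and the refutation firing.**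
For every `εθ ∈ [10⁻²⁶, 10⁻²³]` there are, on the separable infinite-dimensional Hilbert space `ℓ²(ℕ)`, a
SELF-ADJOINT, injective, non-surjective, dense-range operator `T` with `0 ∈ σ(T)`, `‖T‖ = 10⁻²⁰`, of Type 1 via a
unit vector `u₀`, and vectors `x₀, y`, BOTH CYCLIC for `T`, with `y` in the Type-1 cone of `u₀`, `‖x₀‖ = 1`,
`⟨y, x₀ − y⟩ = εθ`, `0.3 ≤ ‖x₀ − y‖ ≤ 0.5`, Case II for ALL `j ≥ 1` strictly, the generic-position bounds, and THE
norm-minimal solution `a` of (26) — whose move is `≥ (εθ)²`, i.e. (27) fails. [cite: Enflo2023, v2 p.13, eq. (26)–(27); pp.1–3; p.6] -/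
theorem minimal_window_satisfiable_C {et : ℝ} (het1 : 1 / 10 ^ 26 ≤ et) (het2 : et ≤ 1 / 10 ^ 23) :
    ∃ (T : ℓ2T →L[ℂ] ℓ2T) (hT1 : ‖T‖ < 1) (u₀ x₀ y : ℓ2T) (a : Vy.ℓ2),
      IsSelfAdjoint T ∧ Function.Injective T ∧ ¬ Function.Surjective T ∧ DenseRange T ∧
      (0 : ℂ) ∈ spectrum ℂ T ∧ ‖T‖ = 1 / 10 ^ 20 ∧ ‖u₀‖ = 1 ∧
      (∀ n : ℕ, 1 ≤ n → ∃ δ : ℝ, 0 < δ ∧ ∀ y' : ℓ2T, Referee.AngleCond u₀ y' →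
          ∃ j : ℕ, n ≤ j ∧ δ * ‖y'‖ ^ 2 ≤ ‖⟪(⇑T)^[j] y', y'⟫_ℂ‖) ∧
      Referee.AngleCond u₀ y ∧ ¬ IsNonCyclic T y ∧ ¬ IsNonCyclic T x₀ ∧
      ‖x₀‖ = 1 ∧ ⟪x₀ - y, y⟫_ℂ = (et : ℂ) ∧ ((0.3 : ℝ) ≤ ‖x₀ - y‖ ∧ ‖x₀ - y‖ ≤ 0.5) ∧
      (∀ j : ℕ, 1 ≤ j → ‖⟪x₀ - y, (T ^ j) y⟫_ℂ‖ < et ^ 4) ∧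
      1 / 10 ^ 21 ≤ ‖⟪y, T y⟫_ℂ‖ ∧ 1 / 10 ^ 21 ≤ ‖T y - (⟪y, T y⟫_ℂ / ((‖y‖ ^ 2 : ℝ) : ℂ)) • y‖ ∧
      IsMinimal (Vy.V T hT1 y) x₀ ‖x₀ - ((1 + et / 10 : ℝ) : ℂ) • y‖ a ∧
      ‖x₀ - ((1 + et / 10 : ℝ) : ℂ) • y‖ < 1 ∧
      et ^ 2 ≤ ‖Vy.V T hT1 y a - ((1 + et / 10 : ℝ) : ℂ) • y‖ := by
  obtain ⟨a, ha, h0, hey, hρ, hcase, hκ, hτ, hrad, hang, hcy, hcx, hmove⟩ := ModelC.facts het1 het2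
  have hu₀ : ‖(lp.single 2 0 (1 : ℂ) : ℓ2T)‖ = 1 := by rw [lp.norm_single (by norm_num)]; simp
  exact ⟨Dc, ModelC.norm_Dc_lt_one, lp.single 2 0 (1 : ℂ), ModelC.x0C et, ModelC.yC, a, Dc_isSelfAdjoint,
    Dc_injective, Dc_not_surjective, Dc_denseRange, zero_mem_spectrum_Dc, norm_Dc, hu₀, ModelC.Dc_type1_via_e0,
    hang, hcy, hcx, h0, hey, hρ, hcase, hκ, hτ, ha, hrad, hmove⟩

end CaseII

/-! ### (6) Verdicts -/

/-- **Lean refuses the p.13 inference (26) ⟹ (27) even with the operator, ALL its standing hypotheses, `T`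
self-adjoint and of Type 1, AND `y`, `x₀` cyclic for `T`.**  Witness: `ℓ²(ℕ)`, `T = D_c`, `εθ = 10⁻²⁴`, and THE
minimiser of (26), whose move is `≥ (εθ)²` by `CaseII.eq27_false_for_minimal`. [cite: Enflo2023, v2 p.13, eq. (27)] -/
theorem not_eq27InferenceCyc : ¬ Eq27InferenceCyc := by
  intro h
  haveI := CaseII.ModelT.separableSpace_ℓ2T
  have het1 : (1 / 10 ^ 26 : ℝ) ≤ 1 / 10 ^ 24 := by norm_num
  have het2 : (1 / 10 ^ 24 : ℝ) ≤ 1 / 10 ^ 23 := by norm_num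
  obtain ⟨T, hT1, u₀, x₀, y, a, hsa, hinj, hsurj, hdense, hspec, hnorm, hu₀, htype, hang, hcy, hcx, h0, hey, hρ,
    hcase, -, -, hmin, -, hmove⟩ := CaseII.minimal_window_satisfiable_C het1 het2
  have hlt := h RoomModelT.ℓ2T CaseII.ModelT.not_finiteDimensional_ℓ2T T hT1 u₀ x₀ y (1 / 10 ^ 24) a hinj hsurj
    hdense hspec hnorm hsa hu₀ htype hang hcy hcx h0 hey (by norm_num) (by norm_num) hρ.1
    (hρ.2.trans (by norm_num)) hcase hmin
  exact absurd hlt (not_lt.2 hmove)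

end Literature.Analysis.OperatorTheory.Enflo2023

end
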